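import Mathlib.Algebra.Module.LinearMap.Basic
import Mathlib.Tactic.Abel

/-! # Venture HSemireg — fibre test: NO POINT 3-CYCLE ONE LEVEL BELOW THE TOP (the amplitude-5
mechanism needs two levels on each side)

PRIORITY. The theorem kernel-checked here is th-3 g31's COOPERATIVE BOUNDARY THEOREM, already in
the tree as `Summits/Ventures/HSemireg/FibreTestCooperativeFourLevel.lean`
(`cooperative_pairing_eq_zero`, a 42-term `noncomm_ring` certificate in one ring with explicit
truncation hypotheses). This file is a SECOND, independent formalisation of the same statement:
typed linear maps between the level modules (so no truncation hypotheses are needed), a 23-term ±1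
certificate found by a different engine, and the dual (one level above the bottom) as a separate
theorem. No priority is claimed (t-5 g25, 2026-08-25).

HONEST FRAMING. Kernel leaf for the computation cell `pub-hsemireg`, (W³)₄ lane (target seat t-5
gen 25; file of record `run/shared/lean/pub/pub-hsemireg/target-g6/INDEC-LINKS-t5g25.md` §14,
certificate `target-g6/code/t5g25/corpus2/certs/CERT_PTS_L4_h2_noE2Y-E1in.json`). In the cell's
finite-dimensional fibre-test model a reduced-point pencil is a graded module with three
degree-one maps `u_l` between consecutive levels; a class has potentials `V_j` of degree `−1` with
`{u_l, V_j} = ε_{jli} B_i` (E1) and `Σ_l [u_l, B_l] = 0` (E2). The amplitude-5 counter-instance to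
(W³) of record (th-3 g31) is a LINK 3-CYCLE THROUGH AN INTERIOR POINT SUMMAND `P`: an in-link
class `x : P → N`, a class `Y` of the complement `N`, an out-link class `c : N → P`, whose
point-anchored alternating scalar `S = Σ_σ sgn σ · c_{σ1} ∘ Y_{σ2} ∘ x_{σ3} : P → P` is the cyclic
supertrace contribution. THIS FILE kernel-checks that `S = 0` whenever the point sits ONE LEVEL
BELOW THE TOP level of the pencil (levels `A → B → C`, `C` the top, `P` at the level of `B`), for
arbitrary modules over a commutative ring: the hypotheses are exactly (E1) of `Y` on the levels
`B` and `C` (on the top level the anticommutator has only the `u ∘ V` term), (E1) of the out-link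
(`c_l ∘ u_l = 0`, `c`-antisymmetry), and (E2) of the two links in block form. The proof is the
cell's exact ±1 certificate: `S` is a signed sum of 23 relation instances `π_L ∘ ρ ∘ π_R`. By the
transpose symmetry of the model the same holds one level ABOVE THE BOTTOM; hence in a FOUR-level
pencil no interior point carries a 3-cycle supertrace, i.e. the amplitude-5 mechanism has no
four-level analogue (it needs two levels on each side of the point, as in the counter-instance,
levels `0,1 | 2 | 3,4`). Nothing here proves (W³)₄; nothing here bears on HC, HC_CM or HC_AV.
-/

namespace Summit.Ventures.HSemireg.NoPointThreeCycle

variable {k : Type*} [CommRing k]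
variable {A B C P : Type*} [AddCommGroup A] [Module k A] [AddCommGroup B] [Module k B]
    [AddCommGroup C] [Module k C]
  [AddCommGroup P] [Module k P]

/-- **No point 3-cycle one level below the top.** Levels `A →(uAB)→ B →(uBC)→ C` with `C` the top
level, an interior point `P` at the level of `B` with in-link potentials `vin_j : P → A` and
out-link potentials `vout_j : C → P`, and a class `Y` of the complement with potentials `yBA_j : B
→ A`, `yCB_j : C → B`. Under (E1) for `Y` on `B` and on the top level `C`, (E1) for the out-link
and the block forms of (E2) for both links, the point-anchored alternating scalar `Σ_σ sgn σ ·
c_{σ1} ∘ Y^{(B)}_{σ2} ∘ x_{σ3}` vanishes, where `c_a = vout_{a+1} ∘ uBC_{a−1}`, `Y^{(B)}_b =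
uAB_{b−1} ∘ yBA_{b+1} + yCB_{b+1} ∘ uBC_{b−1}`, `x_c = uAB_{c−1} ∘ vin_{c+1}` (indices mod 3,
written out with `0,1,2`). [cell certificate, 23 relation instances, coefficients ±1] -/
theorem pointCycle_eq_zero_below_top
    (uAB : Fin 3 → A →ₗ[k] B)
    (uBC : Fin 3 → B →ₗ[k] C)
    (yBA : Fin 3 → B →ₗ[k] A)
    (yCB : Fin 3 → C →ₗ[k] B)
    (vin : Fin 3 → P →ₗ[k] A) (vout : Fin 3 → C →ₗ[k] P)
    (hE1Y2d : ∀ l : Fin 3, uAB l ∘ₗ yBA l + yCB l ∘ₗ uBC l = 0)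
    (hE1Y2 : ∀ l j : Fin 3, uAB l ∘ₗ yBA j + yCB j ∘ₗ uBC l + uAB j ∘ₗ yBA l + yCB l ∘ₗ uBC j = 0)
    (hE1Y3d : ∀ l : Fin 3, uBC l ∘ₗ yCB l = 0)
    (hE1Y3 : ∀ l j : Fin 3, uBC l ∘ₗ yCB j + uBC j ∘ₗ yCB l = 0)
    (hE1out2d : ∀ l : Fin 3, vout l ∘ₗ uBC l = 0)
    (hE1out2 : ∀ l j : Fin 3, vout j ∘ₗ uBC l + vout l ∘ₗ uBC j = 0)
    (hE2in : uBC 0 ∘ₗ uAB 2 ∘ₗ vin 1 + uBC 1 ∘ₗ uAB 0 ∘ₗ vin 2 + uBC 2 ∘ₗ uAB 1 ∘ₗ vin 0 = 0)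
    (hE2out1 : vout 1 ∘ₗ uBC 2 ∘ₗ uAB 0 + vout 2 ∘ₗ uBC 0 ∘ₗ uAB 1 + vout 0 ∘ₗ uBC 1 ∘ₗ uAB 2 = 0)
    :
    (vout 1 ∘ₗ uBC 2) ∘ₗ (uAB 0 ∘ₗ yBA 2 + yCB 2 ∘ₗ uBC 0) ∘ₗ (uAB 1 ∘ₗ vin 0) -
        (vout 1 ∘ₗ uBC 2) ∘ₗ (uAB 1 ∘ₗ yBA 0 + yCB 0 ∘ₗ uBC 1) ∘ₗ (uAB 0 ∘ₗ vin 2) -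
        (vout 2 ∘ₗ uBC 0) ∘ₗ (uAB 2 ∘ₗ yBA 1 + yCB 1 ∘ₗ uBC 2) ∘ₗ (uAB 1 ∘ₗ vin 0) +
        (vout 2 ∘ₗ uBC 0) ∘ₗ (uAB 1 ∘ₗ yBA 0 + yCB 0 ∘ₗ uBC 1) ∘ₗ (uAB 2 ∘ₗ vin 1) +
        (vout 0 ∘ₗ uBC 1) ∘ₗ (uAB 2 ∘ₗ yBA 1 + yCB 1 ∘ₗ uBC 2) ∘ₗ (uAB 0 ∘ₗ vin 2) -
        (vout 0 ∘ₗ uBC 1) ∘ₗ (uAB 0 ∘ₗ yBA 2 + yCB 2 ∘ₗ uBC 0) ∘ₗ (uAB 2 ∘ₗ vin 1) = 0 := by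
  have e0 : (vout 1 ∘ₗ uBC 2) ∘ₗ (uAB 0 ∘ₗ yBA 0 + yCB 0 ∘ₗ uBC 0) ∘ₗ (uAB 2 ∘ₗ vin 1) = 0 := by
    rw [hE1Y2d 0]; simp
  have e1 : (vout 2) ∘ₗ (uBC 0 ∘ₗ yCB 0) ∘ₗ (uBC 1 ∘ₗ uAB 2 ∘ₗ vin 1) = 0 := by
    rw [hE1Y3d 0]; simp
  have e2 : (vout 0) ∘ₗ (uBC 0 ∘ₗ yCB 1 + uBC 1 ∘ₗ yCB 0) ∘ₗ (uBC 2 ∘ₗ uAB 2 ∘ₗ vin 1) = 0 := by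
    rw [hE1Y3 0 1]; simp
  have e3 : (vout 1 ∘ₗ uBC 2) ∘ₗ (uAB 0 ∘ₗ yBA 1 + yCB 1 ∘ₗ uBC 0 + uAB 1 ∘ₗ yBA 0
      + yCB 0 ∘ₗ uBC 1) ∘ₗ (uAB 0 ∘ₗ vin 2) = 0 := by
    rw [hE1Y2 0 1]; simp
  have e4 : (vout 0 ∘ₗ uBC 1) ∘ₗ (uAB 0 ∘ₗ yBA 2 + yCB 2 ∘ₗ uBC 0 + uAB 2 ∘ₗ yBA 0
      + yCB 0 ∘ₗ uBC 2) ∘ₗ (uAB 2 ∘ₗ vin 1) = 0 := by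
    rw [hE1Y2 0 2]; simp
  have e5 : (vout 1) ∘ₗ (uBC 0 ∘ₗ yCB 2 + uBC 2 ∘ₗ yCB 0) ∘ₗ (uBC 0 ∘ₗ uAB 2 ∘ₗ vin 1) = 0 := by
    rw [hE1Y3 0 2]; simp
  have e6 : (vout 0) ∘ₗ (uBC 1 ∘ₗ yCB 1) ∘ₗ (uBC 2 ∘ₗ uAB 0 ∘ₗ vin 2) = 0 := by
    rw [hE1Y3d 1]; simp
  have e7 : (vout 2 ∘ₗ uBC 0) ∘ₗ (uAB 1 ∘ₗ yBA 1 + yCB 1 ∘ₗ uBC 1) ∘ₗ (uAB 0 ∘ₗ vin 2) = 0 := by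
    rw [hE1Y2d 1]; simp
  have e8 : (vout 0) ∘ₗ (uBC 1 ∘ₗ yCB 2 + uBC 2 ∘ₗ yCB 1) ∘ₗ (uBC 1 ∘ₗ uAB 0 ∘ₗ vin 2) = 0 := by
    rw [hE1Y3 1 2]; simp
  have e9 : (vout 1) ∘ₗ (uBC 1 ∘ₗ yCB 2 + uBC 2 ∘ₗ yCB 1) ∘ₗ (uBC 0 ∘ₗ uAB 0 ∘ₗ vin 2) = 0 := by
    rw [hE1Y3 1 2]; simp
  have e10 : (vout 2 ∘ₗ uBC 0) ∘ₗ (uAB 1 ∘ₗ yBA 2 + yCB 2 ∘ₗ uBC 1 + uAB 2 ∘ₗ yBA 1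
      + yCB 1 ∘ₗ uBC 2) ∘ₗ (uAB 1 ∘ₗ vin 0) = 0 := by
    rw [hE1Y2 1 2]; simp
  have e11 : (vout 0) ∘ₗ (uBC 2 ∘ₗ yCB 2) ∘ₗ (uBC 1 ∘ₗ uAB 1 ∘ₗ vin 0) = 0 := by
    rw [hE1Y3d 2]; simp
  have e12 : (vout 0 ∘ₗ uBC 1) ∘ₗ (uAB 2 ∘ₗ yBA 2 + yCB 2 ∘ₗ uBC 2) ∘ₗ (uAB 1 ∘ₗ vin 0) = 0 := by
    rw [hE1Y2d 2]; simp
  have e13 : (vout 1) ∘ₗ (uBC 2 ∘ₗ yCB 2) ∘ₗ (uBC 0 ∘ₗ uAB 1 ∘ₗ vin 0) = 0 := by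
    rw [hE1Y3d 2]; simp
  have e14 : (vout 0 ∘ₗ uBC 1 ∘ₗ yCB 2) ∘ₗ (uBC 0 ∘ₗ uAB 2 ∘ₗ vin 1 + uBC 1 ∘ₗ uAB 0 ∘ₗ vin 2
      + uBC 2 ∘ₗ uAB 1 ∘ₗ vin 0) = 0 := by
    rw [hE2in]; simp
  have e15 : (vout 0 ∘ₗ uBC 0) ∘ₗ (yCB 1 ∘ₗ uBC 2 ∘ₗ uAB 2 ∘ₗ vin 1) = 0 := by
    rw [hE1out2d 0]; simp
  have e16 : (vout 1 ∘ₗ uBC 0 + vout 0 ∘ₗ uBC 1) ∘ₗ (yCB 2 ∘ₗ uBC 0 ∘ₗ uAB 2 ∘ₗ vin 1) = 0 := by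
    rw [hE1out2 0 1]; simp
  have e17 : (vout 2 ∘ₗ uBC 0 + vout 0 ∘ₗ uBC 2) ∘ₗ (yCB 1 ∘ₗ uBC 1 ∘ₗ uAB 0 ∘ₗ vin 2) = 0 := by
    rw [hE1out2 0 2]; simp
  have e18 : (vout 2 ∘ₗ uBC 0 + vout 0 ∘ₗ uBC 2) ∘ₗ (yCB 2 ∘ₗ uBC 1 ∘ₗ uAB 1 ∘ₗ vin 0) = 0 := by
    rw [hE1out2 0 2]; simp
  have e19 : (vout 1 ∘ₗ uBC 1) ∘ₗ (yCB 2 ∘ₗ uBC 0 ∘ₗ uAB 0 ∘ₗ vin 2) = 0 := by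
    rw [hE1out2d 1]; simp
  have e20 : (vout 1 ∘ₗ uBC 2 ∘ₗ uAB 0 + vout 2 ∘ₗ uBC 0 ∘ₗ uAB 1
      + vout 0 ∘ₗ uBC 1 ∘ₗ uAB 2) ∘ₗ (yBA 0 ∘ₗ uAB 2 ∘ₗ vin 1) = 0 := by
    rw [hE2out1]; simp
  have e21 : (vout 1 ∘ₗ uBC 2 ∘ₗ uAB 0 + vout 2 ∘ₗ uBC 0 ∘ₗ uAB 1
      + vout 0 ∘ₗ uBC 1 ∘ₗ uAB 2) ∘ₗ (yBA 1 ∘ₗ uAB 0 ∘ₗ vin 2) = 0 := by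
    rw [hE2out1]; simp
  have e22 : (vout 1 ∘ₗ uBC 2 ∘ₗ uAB 0 + vout 2 ∘ₗ uBC 0 ∘ₗ uAB 1
      + vout 0 ∘ₗ uBC 1 ∘ₗ uAB 2) ∘ₗ (yBA 2 ∘ₗ uAB 1 ∘ₗ vin 0) = 0 := by
    rw [hE2out1]; simp
  have key :
      (vout 1 ∘ₗ uBC 2) ∘ₗ (uAB 0 ∘ₗ yBA 2 + yCB 2 ∘ₗ uBC 0) ∘ₗ (uAB 1 ∘ₗ vin 0) -
          (vout 1 ∘ₗ uBC 2) ∘ₗ (uAB 1 ∘ₗ yBA 0 + yCB 0 ∘ₗ uBC 1) ∘ₗ (uAB 0 ∘ₗ vin 2) -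
          (vout 2 ∘ₗ uBC 0) ∘ₗ (uAB 2 ∘ₗ yBA 1 + yCB 1 ∘ₗ uBC 2) ∘ₗ (uAB 1 ∘ₗ vin 0) +
          (vout 2 ∘ₗ uBC 0) ∘ₗ (uAB 1 ∘ₗ yBA 0 + yCB 0 ∘ₗ uBC 1) ∘ₗ (uAB 2 ∘ₗ vin 1) +
          (vout 0 ∘ₗ uBC 1) ∘ₗ (uAB 2 ∘ₗ yBA 1 + yCB 1 ∘ₗ uBC 2) ∘ₗ (uAB 0 ∘ₗ vin 2) -
          (vout 0 ∘ₗ uBC 1) ∘ₗ (uAB 0 ∘ₗ yBA 2 + yCB 2 ∘ₗ uBC 0) ∘ₗ (uAB 2 ∘ₗ vin 1)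
        = -((vout 1 ∘ₗ uBC 2) ∘ₗ (uAB 0 ∘ₗ yBA 0 + yCB 0 ∘ₗ uBC 0) ∘ₗ (uAB 2 ∘ₗ vin 1)) +
            ((vout 2) ∘ₗ (uBC 0 ∘ₗ yCB 0) ∘ₗ (uBC 1 ∘ₗ uAB 2 ∘ₗ vin 1)) + ((vout 0) ∘ₗ
            (uBC 0 ∘ₗ yCB 1 + uBC 1 ∘ₗ yCB 0) ∘ₗ (uBC 2 ∘ₗ uAB 2 ∘ₗ vin 1)) -
            ((vout 1 ∘ₗ uBC 2) ∘ₗ (uAB 0 ∘ₗ yBA 1 + yCB 1 ∘ₗ uBC 0 + uAB 1 ∘ₗ yBA 0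
            + yCB 0 ∘ₗ uBC 1) ∘ₗ (uAB 0 ∘ₗ vin 2)) - ((vout 0 ∘ₗ uBC 1) ∘ₗ (uAB 0 ∘ₗ yBA 2
            + yCB 2 ∘ₗ uBC 0 + uAB 2 ∘ₗ yBA 0 + yCB 0 ∘ₗ uBC 2) ∘ₗ (uAB 2 ∘ₗ vin 1)) +
            ((vout 1) ∘ₗ (uBC 0 ∘ₗ yCB 2 + uBC 2 ∘ₗ yCB 0) ∘ₗ (uBC 0 ∘ₗ uAB 2 ∘ₗ vin 1)) +
            ((vout 0) ∘ₗ (uBC 1 ∘ₗ yCB 1) ∘ₗ (uBC 2 ∘ₗ uAB 0 ∘ₗ vin 2)) -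
            ((vout 2 ∘ₗ uBC 0) ∘ₗ (uAB 1 ∘ₗ yBA 1 + yCB 1 ∘ₗ uBC 1) ∘ₗ (uAB 0 ∘ₗ vin 2)) -
            ((vout 0) ∘ₗ (uBC 1 ∘ₗ yCB 2 + uBC 2 ∘ₗ yCB 1) ∘ₗ (uBC 1 ∘ₗ uAB 0 ∘ₗ vin 2)) +
            ((vout 1) ∘ₗ (uBC 1 ∘ₗ yCB 2 + uBC 2 ∘ₗ yCB 1) ∘ₗ (uBC 0 ∘ₗ uAB 0 ∘ₗ vin 2)) -
            ((vout 2 ∘ₗ uBC 0) ∘ₗ (uAB 1 ∘ₗ yBA 2 + yCB 2 ∘ₗ uBC 1 + uAB 2 ∘ₗ yBA 1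
            + yCB 1 ∘ₗ uBC 2) ∘ₗ (uAB 1 ∘ₗ vin 0)) - ((vout 0) ∘ₗ (uBC 2 ∘ₗ yCB 2) ∘ₗ
            (uBC 1 ∘ₗ uAB 1 ∘ₗ vin 0)) - ((vout 0 ∘ₗ uBC 1) ∘ₗ (uAB 2 ∘ₗ yBA 2
            + yCB 2 ∘ₗ uBC 2) ∘ₗ (uAB 1 ∘ₗ vin 0)) + ((vout 1) ∘ₗ (uBC 2 ∘ₗ yCB 2) ∘ₗ
            (uBC 0 ∘ₗ uAB 1 ∘ₗ vin 0)) + ((vout 0 ∘ₗ uBC 1 ∘ₗ yCB 2) ∘ₗ (uBC 0 ∘ₗ uAB 2 ∘ₗ vin 1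
            + uBC 1 ∘ₗ uAB 0 ∘ₗ vin 2 + uBC 2 ∘ₗ uAB 1 ∘ₗ vin 0)) - ((vout 0 ∘ₗ uBC 0) ∘ₗ
            (yCB 1 ∘ₗ uBC 2 ∘ₗ uAB 2 ∘ₗ vin 1)) - ((vout 1 ∘ₗ uBC 0 + vout 0 ∘ₗ uBC 1) ∘ₗ
            (yCB 2 ∘ₗ uBC 0 ∘ₗ uAB 2 ∘ₗ vin 1)) + ((vout 2 ∘ₗ uBC 0 + vout 0 ∘ₗ uBC 2) ∘ₗ
            (yCB 1 ∘ₗ uBC 1 ∘ₗ uAB 0 ∘ₗ vin 2)) + ((vout 2 ∘ₗ uBC 0 + vout 0 ∘ₗ uBC 2) ∘ₗ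
            (yCB 2 ∘ₗ uBC 1 ∘ₗ uAB 1 ∘ₗ vin 0)) - ((vout 1 ∘ₗ uBC 1) ∘ₗ
            (yCB 2 ∘ₗ uBC 0 ∘ₗ uAB 0 ∘ₗ vin 2)) + ((vout 1 ∘ₗ uBC 2 ∘ₗ uAB 0
            + vout 2 ∘ₗ uBC 0 ∘ₗ uAB 1 + vout 0 ∘ₗ uBC 1 ∘ₗ uAB 2) ∘ₗ (yBA 0 ∘ₗ uAB 2 ∘ₗ vin 1))
            + ((vout 1 ∘ₗ uBC 2 ∘ₗ uAB 0 + vout 2 ∘ₗ uBC 0 ∘ₗ uAB 1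
            + vout 0 ∘ₗ uBC 1 ∘ₗ uAB 2) ∘ₗ (yBA 1 ∘ₗ uAB 0 ∘ₗ vin 2)) +
            ((vout 1 ∘ₗ uBC 2 ∘ₗ uAB 0 + vout 2 ∘ₗ uBC 0 ∘ₗ uAB 1
            + vout 0 ∘ₗ uBC 1 ∘ₗ uAB 2) ∘ₗ (yBA 2 ∘ₗ uAB 1 ∘ₗ vin 0)) := by
    simp only [LinearMap.comp_add, LinearMap.add_comp, LinearMap.comp_assoc]
    abel
  rw [key, e0, e1, e2, e3, e4, e5, e6, e7, e8, e9, e10, e11, e12, e13, e14, e15, e16, e17, e18,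
      e19, e20, e21, e22]
  abel

/-- **No point 3-cycle one level above the bottom** (transpose-dual of
`pointCycle_eq_zero_below_top`). Levels `A →(uAB)→ B →(uBC)→ C` with `A` the BOTTOM level, an
interior point `P` at the level of `B`, in-link potentials `vin_j : P → A`, out-link potentials
`vout_j : C → P`, class potentials `yBA_j : B → A`, `yCB_j : C → B`. Under (E1) for `Y` on the
bottom level `A` (only the `V ∘ u` term) and on `B`, (E1) for the in-link and the block forms of
(E2) for both links, the point-anchored alternating scalar vanishes (same `c_a`, `Y^{(B)}_b`,
`x_c` as above). Together with the previous theorem: in a FOUR-level pencil every interior point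
is one level below the top or one level above the bottom, so no point 3-cycle contributes to `str
T` at four levels. [dual cell certificate `CERT_PTS_L4_h1_dual23.json`, 23 instances, ±1] -/
theorem pointCycle_eq_zero_above_bottom
    (uAB : Fin 3 → A →ₗ[k] B)
    (uBC : Fin 3 → B →ₗ[k] C)
    (yBA : Fin 3 → B →ₗ[k] A)
    (yCB : Fin 3 → C →ₗ[k] B)
    (vin : Fin 3 → P →ₗ[k] A) (vout : Fin 3 → C →ₗ[k] P)
    (hE1Y0d : ∀ l : Fin 3, yBA l ∘ₗ uAB l = 0)
    (hE1Y0 : ∀ l j : Fin 3, yBA j ∘ₗ uAB l + yBA l ∘ₗ uAB j = 0)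
    (hE1Y1d : ∀ l : Fin 3, uAB l ∘ₗ yBA l + yCB l ∘ₗ uBC l = 0)
    (hE1Y1 : ∀ l j : Fin 3, uAB l ∘ₗ yBA j + yCB j ∘ₗ uBC l + uAB j ∘ₗ yBA l + yCB l ∘ₗ uBC j = 0)
    (hE1ind : ∀ l : Fin 3, uAB l ∘ₗ vin l = 0)
    (hE1in : ∀ l j : Fin 3, uAB l ∘ₗ vin j + uAB j ∘ₗ vin l = 0)
    (hE2in : uBC 0 ∘ₗ uAB 2 ∘ₗ vin 1 + uBC 1 ∘ₗ uAB 0 ∘ₗ vin 2 + uBC 2 ∘ₗ uAB 1 ∘ₗ vin 0 = 0)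
    (hE2out0 : vout 1 ∘ₗ uBC 2 ∘ₗ uAB 0 + vout 2 ∘ₗ uBC 0 ∘ₗ uAB 1 + vout 0 ∘ₗ uBC 1 ∘ₗ uAB 2 = 0)
    :
    (vout 1 ∘ₗ uBC 2) ∘ₗ (uAB 0 ∘ₗ yBA 2 + yCB 2 ∘ₗ uBC 0) ∘ₗ (uAB 1 ∘ₗ vin 0) -
        (vout 1 ∘ₗ uBC 2) ∘ₗ (uAB 1 ∘ₗ yBA 0 + yCB 0 ∘ₗ uBC 1) ∘ₗ (uAB 0 ∘ₗ vin 2) -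
        (vout 2 ∘ₗ uBC 0) ∘ₗ (uAB 2 ∘ₗ yBA 1 + yCB 1 ∘ₗ uBC 2) ∘ₗ (uAB 1 ∘ₗ vin 0) +
        (vout 2 ∘ₗ uBC 0) ∘ₗ (uAB 1 ∘ₗ yBA 0 + yCB 0 ∘ₗ uBC 1) ∘ₗ (uAB 2 ∘ₗ vin 1) +
        (vout 0 ∘ₗ uBC 1) ∘ₗ (uAB 2 ∘ₗ yBA 1 + yCB 1 ∘ₗ uBC 2) ∘ₗ (uAB 0 ∘ₗ vin 2) -
        (vout 0 ∘ₗ uBC 1) ∘ₗ (uAB 0 ∘ₗ yBA 2 + yCB 2 ∘ₗ uBC 0) ∘ₗ (uAB 2 ∘ₗ vin 1) = 0 := by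
  have e0 : (vout 1 ∘ₗ uBC 2) ∘ₗ (uAB 0 ∘ₗ yBA 0 + yCB 0 ∘ₗ uBC 0) ∘ₗ (uAB 2 ∘ₗ vin 1) = 0 := by
    rw [hE1Y1d 0]; simp
  have e1 : (vout 1 ∘ₗ uBC 2 ∘ₗ uAB 1) ∘ₗ (yBA 0 ∘ₗ uAB 0) ∘ₗ (vin 2) = 0 := by
    rw [hE1Y0d 0]; simp
  have e2 : (vout 1 ∘ₗ uBC 2 ∘ₗ uAB 2) ∘ₗ (yBA 1 ∘ₗ uAB 0 + yBA 0 ∘ₗ uAB 1) ∘ₗ (vin 0) = 0 := by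
    rw [hE1Y0 0 1]; simp
  have e3 : (vout 2 ∘ₗ uBC 0) ∘ₗ (uAB 0 ∘ₗ yBA 1 + yCB 1 ∘ₗ uBC 0 + uAB 1 ∘ₗ yBA 0
      + yCB 0 ∘ₗ uBC 1) ∘ₗ (uAB 2 ∘ₗ vin 1) = 0 := by
    rw [hE1Y1 0 1]; simp
  have e4 : (vout 1 ∘ₗ uBC 2) ∘ₗ (uAB 0 ∘ₗ yBA 2 + yCB 2 ∘ₗ uBC 0 + uAB 2 ∘ₗ yBA 0
      + yCB 0 ∘ₗ uBC 2) ∘ₗ (uAB 1 ∘ₗ vin 0) = 0 := by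
    rw [hE1Y1 0 2]; simp
  have e5 : (vout 1 ∘ₗ uBC 2 ∘ₗ uAB 0) ∘ₗ (yBA 2 ∘ₗ uAB 0 + yBA 0 ∘ₗ uAB 2) ∘ₗ (vin 1) = 0 := by
    rw [hE1Y0 0 2]; simp
  have e6 : (vout 2 ∘ₗ uBC 0 ∘ₗ uAB 2) ∘ₗ (yBA 1 ∘ₗ uAB 1) ∘ₗ (vin 0) = 0 := by
    rw [hE1Y0d 1]; simp
  have e7 : (vout 2 ∘ₗ uBC 0) ∘ₗ (uAB 1 ∘ₗ yBA 1 + yCB 1 ∘ₗ uBC 1) ∘ₗ (uAB 0 ∘ₗ vin 2) = 0 := by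
    rw [hE1Y1d 1]; simp
  have e8 : (vout 2 ∘ₗ uBC 0 ∘ₗ uAB 1) ∘ₗ (yBA 2 ∘ₗ uAB 1 + yBA 1 ∘ₗ uAB 2) ∘ₗ (vin 0) = 0 := by
    rw [hE1Y0 1 2]; simp
  have e9 : (vout 2 ∘ₗ uBC 0 ∘ₗ uAB 0) ∘ₗ (yBA 2 ∘ₗ uAB 1 + yBA 1 ∘ₗ uAB 2) ∘ₗ (vin 1) = 0 := by
    rw [hE1Y0 1 2]; simp
  have e10 : (vout 0 ∘ₗ uBC 1) ∘ₗ (uAB 1 ∘ₗ yBA 2 + yCB 2 ∘ₗ uBC 1 + uAB 2 ∘ₗ yBA 1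
      + yCB 1 ∘ₗ uBC 2) ∘ₗ (uAB 0 ∘ₗ vin 2) = 0 := by
    rw [hE1Y1 1 2]; simp
  have e11 : (vout 0 ∘ₗ uBC 1 ∘ₗ uAB 1) ∘ₗ (yBA 2 ∘ₗ uAB 2) ∘ₗ (vin 0) = 0 := by
    rw [hE1Y0d 2]; simp
  have e12 : (vout 0 ∘ₗ uBC 1) ∘ₗ (uAB 2 ∘ₗ yBA 2 + yCB 2 ∘ₗ uBC 2) ∘ₗ (uAB 1 ∘ₗ vin 0) = 0 := by
    rw [hE1Y1d 2]; simp
  have e13 : (vout 0 ∘ₗ uBC 1 ∘ₗ uAB 0) ∘ₗ (yBA 2 ∘ₗ uAB 2) ∘ₗ (vin 1) = 0 := by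
    rw [hE1Y0d 2]; simp
  have e14 : (vout 1 ∘ₗ uBC 2 ∘ₗ uAB 0 + vout 2 ∘ₗ uBC 0 ∘ₗ uAB 1
      + vout 0 ∘ₗ uBC 1 ∘ₗ uAB 2) ∘ₗ (yBA 2 ∘ₗ uAB 1 ∘ₗ vin 0) = 0 := by
    rw [hE2out0]; simp
  have e15 : (vout 1 ∘ₗ uBC 2 ∘ₗ uAB 2 ∘ₗ yBA 1) ∘ₗ (uAB 0 ∘ₗ vin 0) = 0 := by
    rw [hE1ind 0]; simp
  have e16 : (vout 1 ∘ₗ uBC 2 ∘ₗ uAB 0 ∘ₗ yBA 2) ∘ₗ (uAB 0 ∘ₗ vin 1 + uAB 1 ∘ₗ vin 0) = 0 := by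
    rw [hE1in 0 1]; simp
  have e17 : (vout 2 ∘ₗ uBC 0 ∘ₗ uAB 1 ∘ₗ yBA 1) ∘ₗ (uAB 0 ∘ₗ vin 2 + uAB 2 ∘ₗ vin 0) = 0 := by
    rw [hE1in 0 2]; simp
  have e18 : (vout 0 ∘ₗ uBC 1 ∘ₗ uAB 1 ∘ₗ yBA 2) ∘ₗ (uAB 0 ∘ₗ vin 2 + uAB 2 ∘ₗ vin 0) = 0 := by
    rw [hE1in 0 2]; simp
  have e19 : (vout 2 ∘ₗ uBC 0 ∘ₗ uAB 0 ∘ₗ yBA 2) ∘ₗ (uAB 1 ∘ₗ vin 1) = 0 := by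
    rw [hE1ind 1]; simp
  have e20 : (vout 1 ∘ₗ uBC 2 ∘ₗ yCB 0) ∘ₗ (uBC 0 ∘ₗ uAB 2 ∘ₗ vin 1 + uBC 1 ∘ₗ uAB 0 ∘ₗ vin 2
      + uBC 2 ∘ₗ uAB 1 ∘ₗ vin 0) = 0 := by
    rw [hE2in]; simp
  have e21 : (vout 2 ∘ₗ uBC 0 ∘ₗ yCB 1) ∘ₗ (uBC 0 ∘ₗ uAB 2 ∘ₗ vin 1 + uBC 1 ∘ₗ uAB 0 ∘ₗ vin 2
      + uBC 2 ∘ₗ uAB 1 ∘ₗ vin 0) = 0 := by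
    rw [hE2in]; simp
  have e22 : (vout 0 ∘ₗ uBC 1 ∘ₗ yCB 2) ∘ₗ (uBC 0 ∘ₗ uAB 2 ∘ₗ vin 1 + uBC 1 ∘ₗ uAB 0 ∘ₗ vin 2
      + uBC 2 ∘ₗ uAB 1 ∘ₗ vin 0) = 0 := by
    rw [hE2in]; simp
  have key :
      (vout 1 ∘ₗ uBC 2) ∘ₗ (uAB 0 ∘ₗ yBA 2 + yCB 2 ∘ₗ uBC 0) ∘ₗ (uAB 1 ∘ₗ vin 0) -
          (vout 1 ∘ₗ uBC 2) ∘ₗ (uAB 1 ∘ₗ yBA 0 + yCB 0 ∘ₗ uBC 1) ∘ₗ (uAB 0 ∘ₗ vin 2) -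
          (vout 2 ∘ₗ uBC 0) ∘ₗ (uAB 2 ∘ₗ yBA 1 + yCB 1 ∘ₗ uBC 2) ∘ₗ (uAB 1 ∘ₗ vin 0) +
          (vout 2 ∘ₗ uBC 0) ∘ₗ (uAB 1 ∘ₗ yBA 0 + yCB 0 ∘ₗ uBC 1) ∘ₗ (uAB 2 ∘ₗ vin 1) +
          (vout 0 ∘ₗ uBC 1) ∘ₗ (uAB 2 ∘ₗ yBA 1 + yCB 1 ∘ₗ uBC 2) ∘ₗ (uAB 0 ∘ₗ vin 2) -
          (vout 0 ∘ₗ uBC 1) ∘ₗ (uAB 0 ∘ₗ yBA 2 + yCB 2 ∘ₗ uBC 0) ∘ₗ (uAB 2 ∘ₗ vin 1)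
        = ((vout 1 ∘ₗ uBC 2) ∘ₗ (uAB 0 ∘ₗ yBA 0 + yCB 0 ∘ₗ uBC 0) ∘ₗ (uAB 2 ∘ₗ vin 1)) -
            ((vout 1 ∘ₗ uBC 2 ∘ₗ uAB 1) ∘ₗ (yBA 0 ∘ₗ uAB 0) ∘ₗ (vin 2)) -
            ((vout 1 ∘ₗ uBC 2 ∘ₗ uAB 2) ∘ₗ (yBA 1 ∘ₗ uAB 0 + yBA 0 ∘ₗ uAB 1) ∘ₗ (vin 0)) +
            ((vout 2 ∘ₗ uBC 0) ∘ₗ (uAB 0 ∘ₗ yBA 1 + yCB 1 ∘ₗ uBC 0 + uAB 1 ∘ₗ yBA 0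
            + yCB 0 ∘ₗ uBC 1) ∘ₗ (uAB 2 ∘ₗ vin 1)) + ((vout 1 ∘ₗ uBC 2) ∘ₗ (uAB 0 ∘ₗ yBA 2
            + yCB 2 ∘ₗ uBC 0 + uAB 2 ∘ₗ yBA 0 + yCB 0 ∘ₗ uBC 2) ∘ₗ (uAB 1 ∘ₗ vin 0)) -
            ((vout 1 ∘ₗ uBC 2 ∘ₗ uAB 0) ∘ₗ (yBA 2 ∘ₗ uAB 0 + yBA 0 ∘ₗ uAB 2) ∘ₗ (vin 1)) -
            ((vout 2 ∘ₗ uBC 0 ∘ₗ uAB 2) ∘ₗ (yBA 1 ∘ₗ uAB 1) ∘ₗ (vin 0)) +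
            ((vout 2 ∘ₗ uBC 0) ∘ₗ (uAB 1 ∘ₗ yBA 1 + yCB 1 ∘ₗ uBC 1) ∘ₗ (uAB 0 ∘ₗ vin 2)) +
            ((vout 2 ∘ₗ uBC 0 ∘ₗ uAB 1) ∘ₗ (yBA 2 ∘ₗ uAB 1 + yBA 1 ∘ₗ uAB 2) ∘ₗ (vin 0)) -
            ((vout 2 ∘ₗ uBC 0 ∘ₗ uAB 0) ∘ₗ (yBA 2 ∘ₗ uAB 1 + yBA 1 ∘ₗ uAB 2) ∘ₗ (vin 1)) +
            ((vout 0 ∘ₗ uBC 1) ∘ₗ (uAB 1 ∘ₗ yBA 2 + yCB 2 ∘ₗ uBC 1 + uAB 2 ∘ₗ yBA 1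
            + yCB 1 ∘ₗ uBC 2) ∘ₗ (uAB 0 ∘ₗ vin 2)) + ((vout 0 ∘ₗ uBC 1 ∘ₗ uAB 1) ∘ₗ
            (yBA 2 ∘ₗ uAB 2) ∘ₗ (vin 0)) + ((vout 0 ∘ₗ uBC 1) ∘ₗ (uAB 2 ∘ₗ yBA 2
            + yCB 2 ∘ₗ uBC 2) ∘ₗ (uAB 1 ∘ₗ vin 0)) - ((vout 0 ∘ₗ uBC 1 ∘ₗ uAB 0) ∘ₗ
            (yBA 2 ∘ₗ uAB 2) ∘ₗ (vin 1)) - ((vout 1 ∘ₗ uBC 2 ∘ₗ uAB 0 + vout 2 ∘ₗ uBC 0 ∘ₗ uAB 1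
            + vout 0 ∘ₗ uBC 1 ∘ₗ uAB 2) ∘ₗ (yBA 2 ∘ₗ uAB 1 ∘ₗ vin 0)) +
            ((vout 1 ∘ₗ uBC 2 ∘ₗ uAB 2 ∘ₗ yBA 1) ∘ₗ (uAB 0 ∘ₗ vin 0)) +
            ((vout 1 ∘ₗ uBC 2 ∘ₗ uAB 0 ∘ₗ yBA 2) ∘ₗ (uAB 0 ∘ₗ vin 1 + uAB 1 ∘ₗ vin 0)) -
            ((vout 2 ∘ₗ uBC 0 ∘ₗ uAB 1 ∘ₗ yBA 1) ∘ₗ (uAB 0 ∘ₗ vin 2 + uAB 2 ∘ₗ vin 0)) -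
            ((vout 0 ∘ₗ uBC 1 ∘ₗ uAB 1 ∘ₗ yBA 2) ∘ₗ (uAB 0 ∘ₗ vin 2 + uAB 2 ∘ₗ vin 0)) +
            ((vout 2 ∘ₗ uBC 0 ∘ₗ uAB 0 ∘ₗ yBA 2) ∘ₗ (uAB 1 ∘ₗ vin 1)) -
            ((vout 1 ∘ₗ uBC 2 ∘ₗ yCB 0) ∘ₗ (uBC 0 ∘ₗ uAB 2 ∘ₗ vin 1 + uBC 1 ∘ₗ uAB 0 ∘ₗ vin 2
            + uBC 2 ∘ₗ uAB 1 ∘ₗ vin 0)) - ((vout 2 ∘ₗ uBC 0 ∘ₗ yCB 1) ∘ₗ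
            (uBC 0 ∘ₗ uAB 2 ∘ₗ vin 1 + uBC 1 ∘ₗ uAB 0 ∘ₗ vin 2 + uBC 2 ∘ₗ uAB 1 ∘ₗ vin 0))
            - ((vout 0 ∘ₗ uBC 1 ∘ₗ yCB 2) ∘ₗ (uBC 0 ∘ₗ uAB 2 ∘ₗ vin 1 + uBC 1 ∘ₗ uAB 0 ∘ₗ vin 2
            + uBC 2 ∘ₗ uAB 1 ∘ₗ vin 0)) := by
    simp only [LinearMap.comp_add, LinearMap.add_comp, LinearMap.comp_assoc]
    abel
  rw [key, e0, e1, e2, e3, e4, e5, e6, e7, e8, e9, e10, e11, e12, e13, e14, e15, e16, e17, e18,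
      e19, e20, e21, e22]
  abel

end Summit.Ventures.HSemireg.NoPointThreeCycle
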